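import Mathlib
import HarnessLib
import Summits.HubbardSuperconductivity.HubbardSuperconductivity.Theorems.KLProgrammeKLRegimeTwoVolumeLipDoubledTruncIdentity
import Summits.HubbardSuperconductivity.HubbardSuperconductivity.Theorems.KLProgrammeKLRegimeTwoVolumeLipDoubledJumpTransfer
import Summits.HubbardSuperconductivity.HubbardSuperconductivity.Theorems.KLProgrammeKLRegimeTwoVolumeLipRemeasureBase1

/-!
# Route `KLProgramme` — crux K3 ENGINE (stmt-HubbardSuperconductivity-20437 `KLRegimeEngineV17F2`), stub (e) proof-input «(e)-D-ROWS», keying (A′), REKEY-D file D6T-3: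
# THE (Dμ)⁺ ROW OF THE SOURCE-TRUNCATED DOUBLED TOWER, RE-BASED AT BLOCK 1 — the truncated input difference of block `k ≥ 2` re-measured from the truncated input
# difference of block 1 and the truncated born differences of the blocks `1 ≤ k′ < k`
# (seat hubbard-kl-k3c4-p1 g28; truncated-doubled twin of ✓ `…TwoVolumeLipRemeasureBase1.klLipInputDiffSup_le_remeasured_base1` (g25); `--supports` 23356)

* §1 the doubled jumps re-analyse copy by copy: `klJumpD_mul_smul_klSrcAnalysisAt` (`J + 1 ≤ J′`; ✓ `doubleBlock_mul_doubleRows` with the jump plateau fact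
  `sum_klAnisoFamily_eq_one_of_klAnisoFamily_ne_zero` on copy 0 and ✓ `klPlainShift_mul_smul_klPlainAnalysis` on copy 1), `toMatrix'_klJumpD_eq_zero_of_plain`;
* §2 **`klLipInputD_eq_base1_add_sum`** — `klLipInputD … d k = map J⁺_{dk−1,d−1} (klLipInputD … d 1) + Σ_{k′∈[1,k)} map J⁺_{dk−1,dk′} (klLipBornD … d k′)` (`2 ≤ d`, `2 ≤ k`); its
  truncation **`klLipInputDT_eq_srcTrunc_base1_add_sum`** (`srcTrunc_map_srcTrunc` summand by summand) and the two-volume form **`klLipInputDiffDT_eq_srcTrunc_base1_add_sum`**;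
* §3 the summands through ✓ D6T-2 `jumpD_transfer_le_of_wtRows` (`truncRemeasureBase1_le`, `truncRemeasureSummand_le`; defect profiles = the ungraded deep sups at depths `D₀` and `0`);
* §4 **`klLipInputDiffSupDT_le_remeasured_base1`** — the row: same displayed right-hand side as the sector row with `klLipInputDiffSup ↦ klLipInputDiffSupDT`,
  `klLipBornDiffSup ↦ klLipBornDiffSupDT`, coarse profiles of `klLipInputDT L … d 1` and `klLipBornDT L … d k′` on the doubled labels, jump rows of `klJump (bL)` in E1's
  `klScaleWt` currency with `1 ≤ cW`.

Compositions of landed theorems; nothing asserts the (D) rows, stub (e), VL, K3 or superconductivity.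
References: BGM 2006 §2.7 (2.71), §2.8 (2.76)–(2.90), §2.9 (4.3)–(4.6), §3 [cite: BenfattoGiulianiMastropietro2006]; Salmhofer 1998 §4.1.
-/

noncomputable section

namespace Summit.HubbardSuperconductivity.HubbardSuperconductivity.Theorems.TwoVolumeLip

set_option linter.dupNamespace false -- summit = problem name (single-conjunct summit), D-0017

open Finset Literature.MathematicalPhysics.QuantumLattice GrassmannAlgebra Literature.Probability.LatticeModels
open Literature.MathematicalPhysics.QuantumLattice.FermiRG
open Summit.HubbardSuperconductivity.HubbardSuperconductivity.Theorems.KLRegimeSplit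
open Summit.HubbardSuperconductivity.HubbardSuperconductivity.Theorems.KLProgrammeLegKernels
open Summit.HubbardSuperconductivity.HubbardSuperconductivity.Theorems.DispersionFlow
open Summit.HubbardSuperconductivity.HubbardSuperconductivity.Theorems.EngineV8
open Summit.HubbardSuperconductivity.HubbardSuperconductivity.Theorems.TwoVolumeSource
open Summit.HubbardSuperconductivity.HubbardSuperconductivity.Theorems.TwoVolumeDefect

/-! ## §1 The doubled jumps re-analyse copy by copy -/

section JumpId

variable {V M : ℕ} [NeZero V] [NeZero M]

/-- **`klJumpD … J′ J · (ε • klSrcAnalysisAt … J) = ε • klSrcAnalysisAt … J′`** for `J + 1 ≤ J′` (`β ≠ 0`): the doubled jump re-analyses the alive copy at the finer family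
(plateau of `F_J`) and shifts the plain copy identically. [cite: BenfattoGiulianiMastropietro2006, §2.7 (2.70)-(2.71)] -/
theorem klJumpD_mul_smul_klSrcAnalysisAt {β : ℝ} (hβ : β ≠ 0) (μ : ℝ) (K : TrigPolyC4v) {J' J : ℕ} (hJ : J + 1 ≤ J') :
    klJumpD V M β μ K J' J * ((((imagTimeWeight β M : ℝ) : ℂ)) • klSrcAnalysisAt V M β μ K J) =
      (((imagTimeWeight β M : ℝ) : ℂ)) • klSrcAnalysisAt V M β μ K J' := by
  have he : (0 : ℝ) < klE0 := by norm_num [klE0]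
  have hFF : ∀ ω p, bgmFatMultiplier V M klE0 β (nambuXiCT V μ K) J ω p * klAnisoFamily V M β μ K klE0 J ω p = klAnisoFamily V M β μ K klE0 J ω p :=
    fun ω p => bgmFatMultiplier_mul_bgmMultiplier he β (nambuXiCT V μ K) J ω p
  have hF'pl : ∀ (ω' : Fin (sectorCount J')) (p : FreqMomentum V M), klAnisoFamily V M β μ K klE0 J' ω' p ≠ 0 →
      ∑ ω, klAnisoFamily V M β μ K klE0 J ω p = 1 :=
    fun ω' p h => sum_klAnisoFamily_eq_one_of_klAnisoFamily_ne_zero β μ K hJ ω' p h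
  have hA : klJump V M β μ K J' J * ((((imagTimeWeight β M : ℝ) : ℂ)) • sectorAnalysisMatrix V M β (klAnisoFamily V M β μ K klE0 J)) =
      (((imagTimeWeight β M : ℝ) : ℂ)) • sectorAnalysisMatrix V M β (klAnisoFamily V M β μ K klE0 J') := by
    rw [klJump_def]
    exact smul_sectorAnalysis_mul_sectorSub_mul_smul_sectorAnalysis hβ _ _ hFF _ hF'pl
  have hB := klPlainShift_mul_smul_klPlainAnalysis (V := V) (M := M) (N' := sectorCount J') (sectorCount_pos J) (((imagTimeWeight β M : ℝ) : ℂ)) β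
  exact doubleBlock_mul_doubleRows (klJump V M β μ K J' J) (klPlainShift V M (sectorCount J') (sectorCount J))
    (klJumpD V M β μ K J' J) (klJumpD_apply β μ K J' J) _ _ _ _ hA hB _ (smul_klSrcAnalysisAt_apply β μ K J) _ (smul_klSrcAnalysisAt_apply β μ K J')

/-- **Re-analysis at a finer family is the doubled jump of the coarser doubled analysis**: `map (ε•klSrcAnalysisAt J′) G = map J⁺_{J′,J} (map (ε•klSrcAnalysisAt J) G)`. -/
theorem map_smul_klSrcAnalysisAt_eq_map_klJumpD {β : ℝ} (hβ : β ≠ 0) (μ : ℝ) (K : TrigPolyC4v) {J' J : ℕ} (hJ : J + 1 ≤ J') (G : HubbardGrassmann V M) :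
    ExteriorAlgebra.map (Matrix.toLin' ((((imagTimeWeight β M : ℝ) : ℂ)) • klSrcAnalysisAt V M β μ K J')) G =
      ExteriorAlgebra.map (Matrix.toLin' (klJumpD V M β μ K J' J))
        (ExteriorAlgebra.map (Matrix.toLin' ((((imagTimeWeight β M : ℝ) : ℂ)) • klSrcAnalysisAt V M β μ K J)) G) := by
  rw [map_map_eq_map_comp, ← Matrix.toLin'_mul, klJumpD_mul_smul_klSrcAnalysisAt hβ μ K hJ]

omit [NeZero M] in
/-- **The doubled jump sends plain legs to plain legs only** (the `hf` of `Lit/GrassmannSourceGrading.srcTrunc_map_srcTrunc`). -/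
theorem toMatrix'_klJumpD_eq_zero_of_plain (β μ : ℝ) (K : TrigPolyC4v) (J' J : ℕ) (X : SrcLabel V M J) (X' : SrcLabel V M J')
    (hX : X.2 = 1) (hX' : ¬ X'.2 = 1) : LinearMap.toMatrix' (Matrix.toLin' (klJumpD V M β μ K J' J)) X' X = 0 := by
  rw [LinearMap.toMatrix'_toLin', klJumpD_apply, if_neg, if_neg]
  · rintro ⟨h', -⟩; exact hX' h'
  · rintro ⟨-, h⟩; rw [hX] at h; exact absurd h (by decide)

end JumpId

/-! ## §2 The doubled input of block `k ≥ 2` over block 1 and the born terms `1 ≤ k′ < k`; truncation; two volumes -/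

section Base1

variable {V M : ℕ} [NeZero V] [NeZero M]

/-- **`klLipInputD … d k = map J⁺_{dk−1,d−1} (klLipInputD … d 1) + Σ_{k′∈[1,k)} map J⁺_{dk−1,dk′} (klLipBornD … d k′)`** (`2 ≤ d`, `2 ≤ k`, `β ≠ 0`): `𝒱_{dk} = 𝒱_d + Σ Δ_{k′}`
re-analysed at `F_{dk−1}` through the doubled jumps (doubled twin of the `hsum` of ✓ `klLipInputDiff_eq_base1_add_sum`). [cite: BenfattoGiulianiMastropietro2006, §2.7 (2.71)] -/
theorem klLipInputD_eq_base1_add_sum {β : ℝ} (hβ : β ≠ 0) (U μ : ℝ) (K : TrigPolyC4v) {d k : ℕ} (hd : 2 ≤ d) (hk : 2 ≤ k) :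
    klLipInputD V M β U μ K d k =
      ExteriorAlgebra.map (Matrix.toLin' (klJumpD V M β μ K (d * k - 1) (d * 1 - 1))) (klLipInputD V M β U μ K d 1) +
        ∑ k' ∈ Ico 1 k, ExteriorAlgebra.map (Matrix.toLin' (klJumpD V M β μ K (d * k - 1) (d * k'))) (klLipBornD V M β U μ K d k') := by
  have hkk : d * 2 ≤ d * k := Nat.mul_le_mul_left d hk
  have hJ1 : d * 1 - 1 + 1 ≤ d * k - 1 := by omega
  have hJ : ∀ k' ∈ Ico 1 k, d * k' + 1 ≤ d * k - 1 := by
    intro k' hk'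
    have h1 : d * (k' + 1) ≤ d * k := Nat.mul_le_mul_left d (mem_Ico.1 hk').2
    rw [Nat.mul_succ] at h1
    omega
  have hinput : klTowerInput V M β U μ K d k = klTowerInput V M β U μ K d 1 + ∑ k' ∈ Ico 1 k, klTowerIncr V M β U μ K d k' := by
    rw [klTowerInput_eq_zero_add_sum, klTowerInput_eq_zero_add_sum, Finset.range_eq_Ico, Finset.sum_eq_sum_Ico_succ_bot (by omega : 0 < k), add_assoc]
    simp
  rw [klLipInputD_def, hinput, map_add, map_sum, map_smul_klSrcAnalysisAt_eq_map_klJumpD hβ μ K hJ1 (klTowerInput V M β U μ K d 1), ← klLipInputD_def]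
  refine congrArg₂ (· + ·) rfl (Finset.sum_congr rfl fun k' hk' => ?_)
  rw [map_smul_klSrcAnalysisAt_eq_map_klJumpD hβ μ K (hJ k' hk') (klTowerIncr V M β U μ K d k'), ← klLipBornD_def]

/-- The truncation of a finite sum is the sum of the truncations. -/
theorem srcTrunc_finset_sum {Γ : Type*} [Fintype Γ] [DecidableEq Γ] (P : Γ → Prop) [DecidablePred P] (kk : ℕ) {ι : Type*} (s : Finset ι)
    (F : ι → GrassmannAlgebra ℂ Γ) : srcTrunc ℂ P kk (∑ i ∈ s, F i) = ∑ i ∈ s, srcTrunc ℂ P kk (F i) := by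
  classical
  induction s using Finset.induction_on with
  | empty => rw [sum_empty, sum_empty]; exact srcTrunc_eq_zero_of_mem ℂ P (Submodule.zero_mem _)
  | insert a s ha ih => rw [sum_insert ha, sum_insert ha, srcTrunc_add, ih]

/-- **The TRUNCATED doubled input of block `k ≥ 2` over the truncated block-1 input and the truncated born terms** (`2 ≤ d`, `β ≠ 0`):
`klLipInputDT … d k = srcTrunc 3 (map J⁺ (klLipInputDT … d 1) + Σ_{k′∈[1,k)} map J⁺ (klLipBornDT … d k′))` (the jumps send plain legs to plain legs). -/
theorem klLipInputDT_eq_srcTrunc_base1_add_sum {β : ℝ} (hβ : β ≠ 0) (U μ : ℝ) (K : TrigPolyC4v) {d k : ℕ} (hd : 2 ≤ d) (hk : 2 ≤ k) :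
    klLipInputDT V M β U μ K d k =
      srcTrunc ℂ (fun Y : SrcLabel V M (d * k - 1) => Y.2 = 1) 3
        (ExteriorAlgebra.map (Matrix.toLin' (klJumpD V M β μ K (d * k - 1) (d * 1 - 1))) (klLipInputDT V M β U μ K d 1) +
          ∑ k' ∈ Ico 1 k, ExteriorAlgebra.map (Matrix.toLin' (klJumpD V M β μ K (d * k - 1) (d * k'))) (klLipBornDT V M β U μ K d k')) := by
  have h1 : srcTrunc ℂ (fun Y : SrcLabel V M (d * k - 1) => Y.2 = 1) 3
        (ExteriorAlgebra.map (Matrix.toLin' (klJumpD V M β μ K (d * k - 1) (d * 1 - 1))) (klLipInputDT V M β U μ K d 1)) =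
      srcTrunc ℂ (fun Y : SrcLabel V M (d * k - 1) => Y.2 = 1) 3
        (ExteriorAlgebra.map (Matrix.toLin' (klJumpD V M β μ K (d * k - 1) (d * 1 - 1))) (klLipInputD V M β U μ K d 1)) := by
    rw [klLipInputDT_def]
    exact srcTrunc_map_srcTrunc (R := ℂ) (P := fun Y : SrcLabel V M (d * 1 - 1) => Y.2 = 1) (P' := fun Y : SrcLabel V M (d * k - 1) => Y.2 = 1)
      (Matrix.toLin' (klJumpD V M β μ K (d * k - 1) (d * 1 - 1))) (toMatrix'_klJumpD_eq_zero_of_plain β μ K (d * k - 1) (d * 1 - 1)) 3 _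
  have h2 : ∀ k', srcTrunc ℂ (fun Y : SrcLabel V M (d * k - 1) => Y.2 = 1) 3
        (ExteriorAlgebra.map (Matrix.toLin' (klJumpD V M β μ K (d * k - 1) (d * k'))) (klLipBornDT V M β U μ K d k')) =
      srcTrunc ℂ (fun Y : SrcLabel V M (d * k - 1) => Y.2 = 1) 3
        (ExteriorAlgebra.map (Matrix.toLin' (klJumpD V M β μ K (d * k - 1) (d * k'))) (klLipBornD V M β U μ K d k')) := by
    intro k'
    rw [klLipBornDT_def]
    exact srcTrunc_map_srcTrunc (R := ℂ) (P := fun Y : SrcLabel V M (d * k') => Y.2 = 1) (P' := fun Y : SrcLabel V M (d * k - 1) => Y.2 = 1)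
      (Matrix.toLin' (klJumpD V M β μ K (d * k - 1) (d * k'))) (toMatrix'_klJumpD_eq_zero_of_plain β μ K (d * k - 1) (d * k')) 3 _
  rw [klLipInputDT_def, klLipInputD_eq_base1_add_sum hβ U μ K hd hk, srcTrunc_add, srcTrunc_add, srcTrunc_finset_sum, srcTrunc_finset_sum, h1]
  exact congrArg₂ (· + ·) rfl (Finset.sum_congr rfl fun k' _ => (h2 k').symm)

end Base1

section Base1Two

variable {L b M : ℕ} [NeZero L] [NeZero (b * L)] [NeZero M] {n : ℕ}

omit [NeZero M] in
/-- The doubled glue of a finite sum. -/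
theorem klGlueD_finset_sum {ι : Type*} (s : Finset ι) (W : ι → GrassmannAlgebra ℂ (SrcLabel L M n)) :
    klGlueD L b M n (∑ i ∈ s, W i) = ∑ i ∈ s, klGlueD L b M n (W i) := by
  classical
  induction s using Finset.induction_on with
  | empty =>
    rw [sum_empty, sum_empty, klGlueD_def]
    exact sum_eq_zero fun B _ => map_zero _
  | insert a s ha ih => rw [sum_insert ha, sum_insert ha, klGlueD_add, ih]

/-- **The TRUNCATED input difference of block `k ≥ 2` as the truncation of (transferred block-1 input difference + re-measured born differences)** (`2 ≤ d`, `β ≠ 0`):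
`klLipInputDiffDT … d k = srcTrunc 3 ((map J′⁺ (klLipInputDT (bL) d 1) − klGlueD (map J⁺ (klLipInputDT L d 1))) + Σ_{k′∈[1,k)} (map J′⁺ (klLipBornDT (bL) d k′) − klGlueD (map J⁺ (klLipBornDT L d k′))))`. -/
theorem klLipInputDiffDT_eq_srcTrunc_base1_add_sum {β : ℝ} (hβ : β ≠ 0) (U μ : ℝ) (K : TrigPolyC4v) {d k : ℕ} (hd : 2 ≤ d) (hk : 2 ≤ k) :
    klLipInputDiffDT L b M β U μ K d k =
      srcTrunc ℂ (fun Y : SrcLabel (b * L) M (d * k - 1) => Y.2 = 1) 3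
        ((ExteriorAlgebra.map (Matrix.toLin' (klJumpD (b * L) M β μ K (d * k - 1) (d * 1 - 1))) (klLipInputDT (b * L) M β U μ K d 1) -
            klGlueD L b M (d * k - 1)
              (ExteriorAlgebra.map (Matrix.toLin' (klJumpD L M β μ K (d * k - 1) (d * 1 - 1))) (klLipInputDT L M β U μ K d 1))) +
          ∑ k' ∈ Ico 1 k,
            (ExteriorAlgebra.map (Matrix.toLin' (klJumpD (b * L) M β μ K (d * k - 1) (d * k'))) (klLipBornDT (b * L) M β U μ K d k') -
              klGlueD L b M (d * k - 1)
                (ExteriorAlgebra.map (Matrix.toLin' (klJumpD L M β μ K (d * k - 1) (d * k'))) (klLipBornDT L M β U μ K d k')))) := by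
  rw [klLipInputDiffDT_def, klLipInputDT_eq_srcTrunc_base1_add_sum (V := b * L) hβ U μ K hd hk, klLipInputDT_eq_srcTrunc_base1_add_sum (V := L) hβ U μ K hd hk,
    klGlueD_srcTrunc, ← srcTrunc_sub, klGlueD_add, klGlueD_finset_sum, Finset.sum_sub_distrib]
  congr 1
  abel

end Base1Two

/-! ## §3 The summands through the doubled jump transfer door -/

section Summands

variable {L b M : ℕ} [NeZero L] [NeZero (b * L)] [NeZero M]

/-- **One jump-transferred summand of the truncated (Dμ)⁺ row** (free elements `W′` fine / `W` coarse at family `J`, jumped to `F_{dk−1}`; jump rows of `klJump (bL) (dk−1) J` in E1's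
`klScaleWt (bL) M β j_r` currency, `1 ≤ cW`, `0 ≤ Λ_T ≤ Λ_{j_r}`; defect `W′ − klGlueD W` read by a near profile `E` (within `r` of the `(D₀+r)`-deep pin) and a global one `ND`). -/
theorem truncRemeasureSummand_le {β : ℝ} (hβ : 0 < β) (μ : ℝ) (K : TrigPolyC4v) (d k J jr : ℕ)
    {ΛT cW : ℝ} (hΛT : 0 ≤ ΛT) (hΛr : ΛT ≤ klScale klE0 jr) (hcW1 : 1 ≤ cW)
    (hrow : ∀ x, ∑ y', ‖klJump (b * L) M β μ K (d * k - 1) J x y'‖ *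
      klScaleWt (b * L) M β jr {latticeLegPos (2 * (2 * M)) x, latticeLegPos (2 * (2 * M)) y'} ≤ cW)
    (hcol : ∀ y', ∑ x, ‖klJump (b * L) M β μ K (d * k - 1) J x y'‖ *
      klScaleWt (b * L) M β jr {latticeLegPos (2 * (2 * M)) x, latticeLegPos (2 * (2 * M)) y'} ≤ cW)
    (W' : GrassmannAlgebra ℂ (SrcLabel (b * L) M J)) (W : GrassmannAlgebra ℂ (SrcLabel L M J))
    {n : ℕ} (p : Fin (n + 1)) (w' : SrcLabel (b * L) M (d * k - 1)) (D₀ r : ℕ) (hD₀ : 2 * r ≤ D₀)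
    (hw : ∀ i, D₀ + r ≤ (w'.1.1.2 i).val % L ∧ (w'.1.1.2 i).val % L + (D₀ + r) < L)
    {N Nfar E ND : ℝ} (hN0 : 0 ≤ N) (hNfar0 : 0 ≤ Nfar) (hE0 : 0 ≤ E) (hND0 : 0 ≤ ND)
    (hN : ∀ y, ∑ Y ∈ univ.filter (fun Y : Fin (n + 1) → SrcLabel L M J => Y p = y), ‖kernel ℂ W (n + 1) Y‖ ≤ N)
    (hNfar : ∀ y (i : Fin (n + 1)),
      ∑ Y ∈ univ.filter (fun Y : Fin (n + 1) → SrcLabel L M J => Y p = y ∧ r < Torus.tnorm ((Y p).1.1.2 - (Y i).1.1.2)), ‖kernel ℂ W (n + 1) Y‖ ≤ Nfar)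
    (hE : ∀ y' : SrcLabel (b * L) M J, Torus.tnorm (w'.1.1.2 - y'.1.1.2) ≤ r →
      ∑ Y' ∈ univ.filter (fun Y' : Fin (n + 1) → SrcLabel (b * L) M J => Y' p = y'), ‖kernel ℂ (W' - klGlueD L b M J W) (n + 1) Y'‖ ≤ E)
    (hND : ∀ y', ∑ Y' ∈ univ.filter (fun Y' : Fin (n + 1) → SrcLabel (b * L) M J => Y' p = y'), ‖kernel ℂ (W' - klGlueD L b M J W) (n + 1) Y'‖ ≤ ND) :
    ∑ X' ∈ univ.filter (fun X' : Fin (n + 1) → SrcLabel (b * L) M (d * k - 1) => X' p = w'),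
        ‖kernel ℂ (ExteriorAlgebra.map (Matrix.toLin' (klJumpD (b * L) M β μ K (d * k - 1) J)) W' -
            klGlueD L b M (d * k - 1) (ExteriorAlgebra.map (Matrix.toLin' (klJumpD L M β μ K (d * k - 1) J)) W)) (n + 1) X'‖ ≤
      cW ^ n * (cW * E + cW / (1 + ΛT * ((r : ℝ) + 1)) * ND) +
        (2 * cW ^ n * (cW / (1 + ΛT * ((r : ℝ) + 1))) * N + n * cW ^ n * (5 * (cW / (1 + ΛT * ((r : ℝ) + 1))) * N + 2 * cW * Nfar)) := by
  have hrow' : ∀ x : SpaceTimeIdx (b * L) M × SectorLeg (sectorCount (d * k - 1)),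
      ∑ y', ‖klJump (b * L) M β μ K (d * k - 1) J x y'‖ * (1 + ΛT * (Torus.tnorm (x.1.2 - y'.1.2) : ℝ)) ≤ cW := fun x => by
    refine (sum_le_sum fun y' _ => ?_).trans (hrow x)
    exact mul_le_mul_of_nonneg_left
      (one_add_mul_tnorm_le_klScaleWt_pair hβ.le hΛr ((x.1, y'.2) : SpaceTimeIdx (b * L) M × SectorLeg (sectorCount J)) y') (norm_nonneg _)
  have hcol' : ∀ y' : SpaceTimeIdx (b * L) M × SectorLeg (sectorCount J),
      ∑ x, ‖klJump (b * L) M β μ K (d * k - 1) J x y'‖ * (1 + ΛT * (Torus.tnorm (x.1.2 - y'.1.2) : ℝ)) ≤ cW := fun y' => by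
    refine (sum_le_sum fun x _ => ?_).trans (hcol y')
    exact mul_le_mul_of_nonneg_left
      (one_add_mul_tnorm_le_klScaleWt_pair hβ.le hΛr ((x.1, y'.2) : SpaceTimeIdx (b * L) M × SectorLeg (sectorCount J)) y') (norm_nonneg _)
  exact jumpD_transfer_le_of_wtRows hβ μ K W' W hΛT hcW1 hrow' hcol' p w' D₀ r hD₀ hw hN0 hNfar0 hE0 hND0 hN hNfar hE hND

end Summands

/-! ## §4 THE (Dμ)⁺ ROW OF THE TRUNCATED DOUBLED TOWER, RE-BASED AT BLOCK 1 -/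

section RowDmuDT

variable {L b M : ℕ} [NeZero L] [NeZero (b * L)] [NeZero M]

/-- Within `r` of a `(D + r)`-deep doubled label, the pinned profile of the truncated input difference is at most its ungraded deep sup at depth `D`. -/
theorem sum_pinned_norm_kernel_inputDiffDT_le_sup_of_near (β U μ : ℝ) (K : TrigPolyC4v) (d k : ℕ) {m : ℕ} (q : Fin m) {n₂ D r : ℕ}
    {w' : SrcLabel (b * L) M n₂} (hw : ∀ j, D + r ≤ (w'.1.1.2 j).val % L ∧ (w'.1.1.2 j).val % L + (D + r) < L)
    (y' : SrcLabel (b * L) M (d * k - 1)) (hy : Torus.tnorm (w'.1.1.2 - y'.1.1.2) ≤ r) :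
    ∑ X ∈ univ.filter (fun X : Fin m → SrcLabel (b * L) M (d * k - 1) => X q = y'), ‖kernel ℂ (klLipInputDiffDT L b M β U μ K d k) m X‖ ≤
      klLipInputDiffSupDT L b M β U μ K d k m D :=
  sum_le_klLipInputDiffSupDT β U μ K d k m D q (mem_klDeepPinsD.2 (mem_klDeepPins_of_tnorm_le (w := w'.1) hw hy))

/-- Every pinned profile of the truncated input difference is at most its ungraded deep sup at depth `0`. -/
theorem sum_pinned_norm_kernel_inputDiffDT_le_sup_zero (β U μ : ℝ) (K : TrigPolyC4v) (d k : ℕ) {m : ℕ} (q : Fin m) (y' : SrcLabel (b * L) M (d * k - 1)) :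
    ∑ X ∈ univ.filter (fun X : Fin m → SrcLabel (b * L) M (d * k - 1) => X q = y'), ‖kernel ℂ (klLipInputDiffDT L b M β U μ K d k) m X‖ ≤
      klLipInputDiffSupDT L b M β U μ K d k m 0 :=
  sum_le_klLipInputDiffSupDT β U μ K d k m 0 q (mem_klDeepPinsD.2 (mem_klDeepPins_zero L y'.1))

/-- Within `r` of a `(D + r)`-deep doubled label, the pinned profile of the truncated born difference is at most its ungraded deep sup at depth `D`. -/
theorem sum_pinned_norm_kernel_bornDiffDT_le_sup_of_near (β U μ : ℝ) (K : TrigPolyC4v) (d k : ℕ) {m : ℕ} (q : Fin m) {n₂ D r : ℕ}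
    {w' : SrcLabel (b * L) M n₂} (hw : ∀ j, D + r ≤ (w'.1.1.2 j).val % L ∧ (w'.1.1.2 j).val % L + (D + r) < L)
    (y' : SrcLabel (b * L) M (d * k)) (hy : Torus.tnorm (w'.1.1.2 - y'.1.1.2) ≤ r) :
    ∑ X ∈ univ.filter (fun X : Fin m → SrcLabel (b * L) M (d * k) => X q = y'), ‖kernel ℂ (klLipBornDiffDT L b M β U μ K d k) m X‖ ≤
      klLipBornDiffSupDT L b M β U μ K d k m D :=
  sum_le_klLipBornDiffSupDT β U μ K d k m D q (mem_klDeepPinsD.2 (mem_klDeepPins_of_tnorm_le (w := w'.1) hw hy))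

/-- Every pinned profile of the truncated born difference is at most its ungraded deep sup at depth `0`. -/
theorem sum_pinned_norm_kernel_bornDiffDT_le_sup_zero (β U μ : ℝ) (K : TrigPolyC4v) (d k : ℕ) {m : ℕ} (q : Fin m) (y' : SrcLabel (b * L) M (d * k)) :
    ∑ X ∈ univ.filter (fun X : Fin m → SrcLabel (b * L) M (d * k) => X q = y'), ‖kernel ℂ (klLipBornDiffDT L b M β U μ K d k) m X‖ ≤
      klLipBornDiffSupDT L b M β U μ K d k m 0 :=
  sum_le_klLipBornDiffSupDT β U μ K d k m 0 q (mem_klDeepPinsD.2 (mem_klDeepPins_zero L y'.1))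

set_option maxHeartbeats 400000 in -- the identity, the domination and the summands in one declaration
/-- **THE (Dμ)⁺ ROW OF THE SOURCE-TRUNCATED DOUBLED TOWER, RE-BASED AT BLOCK 1** (`2 ≤ d`, `2 ≤ k`, degree `n+1`, depth `D₀ + r`, `2r ≤ D₀`; block-dependent jump rows `cW k′ ≥ 1`,
`cW₁ ≥ 1` for the base jump `klJump (bL) (dk−1) (d−1)`, in E1's `klScaleWt` currency; coarse profiles of `klLipInputDT L … d 1` and of `klLipBornDT L … d k′` on the doubled labels) —
the truncated-doubled twin of ✓ `klLipInputDiffSup_le_remeasured_base1`, same displayed right-hand side. -/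
theorem klLipInputDiffSupDT_le_remeasured_base1 {β : ℝ} (hβ : 0 < β) (U μ : ℝ) (K : TrigPolyC4v) {d k : ℕ} (hd : 2 ≤ d) (hk : 2 ≤ k) (n D₀ r jr : ℕ)
    (hD₀ : 2 * r ≤ D₀) {ΛT : ℝ} {cW : ℕ → ℝ} {cW₁ : ℝ} (hΛT : 0 ≤ ΛT) (hΛr : ΛT ≤ klScale klE0 jr) (hcW : ∀ k', 1 ≤ cW k') (hcW₁ : 1 ≤ cW₁)
    (hrow : ∀ k' ∈ Ico 1 k, ∀ x, ∑ y', ‖klJump (b * L) M β μ K (d * k - 1) (d * k') x y'‖ *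
      klScaleWt (b * L) M β jr {latticeLegPos (2 * (2 * M)) x, latticeLegPos (2 * (2 * M)) y'} ≤ cW k')
    (hcol : ∀ k' ∈ Ico 1 k, ∀ y', ∑ x, ‖klJump (b * L) M β μ K (d * k - 1) (d * k') x y'‖ *
      klScaleWt (b * L) M β jr {latticeLegPos (2 * (2 * M)) x, latticeLegPos (2 * (2 * M)) y'} ≤ cW k')
    (hrow₁ : ∀ x, ∑ y', ‖klJump (b * L) M β μ K (d * k - 1) (d * 1 - 1) x y'‖ *
      klScaleWt (b * L) M β jr {latticeLegPos (2 * (2 * M)) x, latticeLegPos (2 * (2 * M)) y'} ≤ cW₁)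
    (hcol₁ : ∀ y', ∑ x, ‖klJump (b * L) M β μ K (d * k - 1) (d * 1 - 1) x y'‖ *
      klScaleWt (b * L) M β jr {latticeLegPos (2 * (2 * M)) x, latticeLegPos (2 * (2 * M)) y'} ≤ cW₁)
    {NI NIfar : ℝ} (hNI0 : 0 ≤ NI) (hNIfar0 : 0 ≤ NIfar)
    (hNI : ∀ (q : Fin (n + 1)) y, ∑ Y ∈ univ.filter (fun Y : Fin (n + 1) → SrcLabel L M (d * 1 - 1) => Y q = y),
      ‖kernel ℂ (klLipInputDT L M β U μ K d 1) (n + 1) Y‖ ≤ NI)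
    (hNIfar : ∀ (q : Fin (n + 1)) y (i : Fin (n + 1)),
      ∑ Y ∈ univ.filter (fun Y : Fin (n + 1) → SrcLabel L M (d * 1 - 1) => Y q = y ∧ r < Torus.tnorm ((Y q).1.1.2 - (Y i).1.1.2)),
        ‖kernel ℂ (klLipInputDT L M β U μ K d 1) (n + 1) Y‖ ≤ NIfar)
    {N Nfar : ℕ → ℝ} (hN0 : ∀ k', 0 ≤ N k') (hNfar0 : ∀ k', 0 ≤ Nfar k')
    (hN : ∀ k' ∈ Ico 1 k, ∀ (q : Fin (n + 1)) (y : SrcLabel L M (d * k')),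
      ∑ Y ∈ univ.filter (fun Y : Fin (n + 1) → SrcLabel L M (d * k') => Y q = y), ‖kernel ℂ (klLipBornDT L M β U μ K d k') (n + 1) Y‖ ≤ N k')
    (hNfar : ∀ k' ∈ Ico 1 k, ∀ (q : Fin (n + 1)) (y : SrcLabel L M (d * k')) (i : Fin (n + 1)),
      ∑ Y ∈ univ.filter (fun Y : Fin (n + 1) → SrcLabel L M (d * k') => Y q = y ∧ r < Torus.tnorm ((Y q).1.1.2 - (Y i).1.1.2)),
        ‖kernel ℂ (klLipBornDT L M β U μ K d k') (n + 1) Y‖ ≤ Nfar k') :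
    klLipInputDiffSupDT L b M β U μ K d k (n + 1) (D₀ + r) ≤
      (cW₁ ^ n * (cW₁ * klLipInputDiffSupDT L b M β U μ K d 1 (n + 1) D₀ + cW₁ / (1 + ΛT * ((r : ℝ) + 1)) * klLipInputDiffSupDT L b M β U μ K d 1 (n + 1) 0) +
          (2 * cW₁ ^ n * (cW₁ / (1 + ΛT * ((r : ℝ) + 1))) * NI + n * cW₁ ^ n * (5 * (cW₁ / (1 + ΛT * ((r : ℝ) + 1))) * NI + 2 * cW₁ * NIfar))) +
        ∑ k' ∈ Ico 1 k,
          (cW k' ^ n * (cW k' * klLipBornDiffSupDT L b M β U μ K d k' (n + 1) D₀ +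
              cW k' / (1 + ΛT * ((r : ℝ) + 1)) * klLipBornDiffSupDT L b M β U μ K d k' (n + 1) 0) +
            (2 * cW k' ^ n * (cW k' / (1 + ΛT * ((r : ℝ) + 1))) * N k' +
              n * cW k' ^ n * (5 * (cW k' / (1 + ΛT * ((r : ℝ) + 1))) * N k' + 2 * cW k' * Nfar k'))) := by
  classical
  have hBD0 : ∀ k' R, 0 ≤ klLipBornDiffSupDT L b M β U μ K d k' (n + 1) R := fun k' R => klLipBornDiffSupDT_nonneg β U μ K d k' (n + 1) R
  have hID0 : ∀ R, 0 ≤ klLipInputDiffSupDT L b M β U μ K d 1 (n + 1) R := fun R => klLipInputDiffSupDT_nonneg β U μ K d 1 (n + 1) R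
  have hcW₁0 : 0 ≤ cW₁ := zero_le_one.trans hcW₁
  have hτ₁ : 0 ≤ cW₁ / (1 + ΛT * ((r : ℝ) + 1)) := by positivity
  have h0 : 0 ≤ (cW₁ ^ n * (cW₁ * klLipInputDiffSupDT L b M β U μ K d 1 (n + 1) D₀ + cW₁ / (1 + ΛT * ((r : ℝ) + 1)) * klLipInputDiffSupDT L b M β U μ K d 1 (n + 1) 0) +
          (2 * cW₁ ^ n * (cW₁ / (1 + ΛT * ((r : ℝ) + 1))) * NI + n * cW₁ ^ n * (5 * (cW₁ / (1 + ΛT * ((r : ℝ) + 1))) * NI + 2 * cW₁ * NIfar))) +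
        ∑ k' ∈ Ico 1 k,
          (cW k' ^ n * (cW k' * klLipBornDiffSupDT L b M β U μ K d k' (n + 1) D₀ +
              cW k' / (1 + ΛT * ((r : ℝ) + 1)) * klLipBornDiffSupDT L b M β U μ K d k' (n + 1) 0) +
            (2 * cW k' ^ n * (cW k' / (1 + ΛT * ((r : ℝ) + 1))) * N k' +
              n * cW k' ^ n * (5 * (cW k' / (1 + ΛT * ((r : ℝ) + 1))) * N k' + 2 * cW k' * Nfar k'))) := by
    have h1 := hID0 D₀; have h2 := hID0 0
    refine add_nonneg (by positivity) (sum_nonneg fun k' _ => ?_)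
    have h3 := hBD0 k' D₀; have h4 := hBD0 k' 0; have h5 := hN0 k'; have h6 := hNfar0 k'; have h7 : 0 ≤ cW k' := zero_le_one.trans (hcW k')
    positivity
  refine klLipInputDiffSupDT_le_of_forall β U μ K d k (n + 1) (D₀ + r) h0 fun q w hw => ?_
  have hw' : ∀ j, D₀ + r ≤ (w.1.1.2 j).val % L ∧ (w.1.1.2 j).val % L + (D₀ + r) < L := mem_klDeepPins.1 (mem_klDeepPinsD.1 hw)
  rw [klLipInputDiffDT_eq_srcTrunc_base1_add_sum hβ.ne' U μ K hd hk]
  -- abbreviate the summands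
  set A := ExteriorAlgebra.map (Matrix.toLin' (klJumpD (b * L) M β μ K (d * k - 1) (d * 1 - 1))) (klLipInputDT (b * L) M β U μ K d 1) -
      klGlueD L b M (d * k - 1) (ExteriorAlgebra.map (Matrix.toLin' (klJumpD L M β μ K (d * k - 1) (d * 1 - 1))) (klLipInputDT L M β U μ K d 1)) with hA
  set B : ℕ → GrassmannAlgebra ℂ (SrcLabel (b * L) M (d * k - 1)) := fun k' =>
      ExteriorAlgebra.map (Matrix.toLin' (klJumpD (b * L) M β μ K (d * k - 1) (d * k'))) (klLipBornDT (b * L) M β U μ K d k') -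
        klGlueD L b M (d * k - 1) (ExteriorAlgebra.map (Matrix.toLin' (klJumpD L M β μ K (d * k - 1) (d * k'))) (klLipBornDT L M β U μ K d k')) with hB
  calc _ ≤ ∑ X ∈ univ.filter (fun X : Fin (n + 1) → SrcLabel (b * L) M (d * k - 1) => X q = w),
        (‖kernel ℂ A (n + 1) X‖ + ∑ k' ∈ Ico 1 k, ‖kernel ℂ (B k') (n + 1) X‖) := by
        refine Finset.sum_le_sum fun X _ => ?_
        rw [kernel_srcTrunc]
        split_ifs
        · rw [kernel_add, kernel_sum]
          exact (norm_add_le _ _).trans (by gcongr; exact norm_sum_le _ _)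
        · rw [norm_zero]; positivity
    _ ≤ _ := by
        rw [Finset.sum_add_distrib, Finset.sum_comm]
        refine add_le_add ?_ (Finset.sum_le_sum fun k' hk' => ?_)
        · exact truncRemeasureSummand_le hβ μ K d k (d * 1 - 1) jr hΛT hΛr hcW₁ hrow₁ hcol₁ _ _ q w D₀ r hD₀ hw' hNI0 hNIfar0 (hID0 D₀) (hID0 0) (hNI q) (hNIfar q)
            (fun y' hy' => by rw [← klLipInputDiffDT_def]; exact sum_pinned_norm_kernel_inputDiffDT_le_sup_of_near β U μ K d 1 q hw' y' hy')
            (fun y' => by rw [← klLipInputDiffDT_def]; exact sum_pinned_norm_kernel_inputDiffDT_le_sup_zero β U μ K d 1 q y')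
        · exact truncRemeasureSummand_le hβ μ K d k (d * k') jr hΛT hΛr (hcW k') (hrow k' hk') (hcol k' hk') _ _ q w D₀ r hD₀ hw' (hN0 k') (hNfar0 k')
            (hBD0 k' D₀) (hBD0 k' 0) (hN k' hk' q) (hNfar k' hk' q)
            (fun y' hy' => by rw [← klLipBornDiffDT_def]; exact sum_pinned_norm_kernel_bornDiffDT_le_sup_of_near β U μ K d k' q hw' y' hy')
            (fun y' => by rw [← klLipBornDiffDT_def]; exact sum_pinned_norm_kernel_bornDiffDT_le_sup_zero β U μ K d k' q y')

end RowDmuDT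

end Summit.HubbardSuperconductivity.HubbardSuperconductivity.Theorems.TwoVolumeLip

end
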